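import Summits.BirchSwinnertonDyer.BirchSwinnertonDyer.Theses.EisensteinPrimes
import Summits.BirchSwinnertonDyer.BirchSwinnertonDyer.Theorems.Rank1ResidualX1Defs
import Literature.NumberTheory.EllipticCurves.Wuthrich2014.ReducibleDivisibility
import Literature.NumberTheory.EllipticCurves.IwasawaAlgebraGenericTwistFiniteProofs
import HarnessLib

/-!
# Crux 5 `MazurMCOnX1RankZero` (stmt-BirchSwinnertonDyer-19035) — ideation seat bsd-eis-idea g19,
# lens «relocation along branch 0» (non-critical Tate-twist points `t_j = γ^j − 1`, `j ∈ (p−1)ℤ_{>0}`):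
# the TYPED candidate `TwistedUnitAt W p j` and its PROVED door; verdict of the lens memo
# (`Cruxes/MazurMCOnX1RankZero/Ideas/twist-relocation-g19-lens-memo.md`): COSTUME — no card filed.

What is typed here (sorry-free; nothing booked; no named fact):

* `twistConst p j = u^j − 1 ∈ 𝔪_{ℤ_p}` (`u = cyclotomicGenerator p = 1 + p^{e₀}`) and the twist element
  `twistElt p j = T − (u^j − 1) ∈ 𝔪_Λ` (`twistConst_mem_maximalIdeal`, `twistElt_mem_maximalIdeal`);
* the local-ring step every «evaluate the Kato–Wuthrich quotient elsewhere» idea rests on: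
  `isUnit_of_isUnit_mk` — for an ideal `I ⊆ 𝔪_Λ`, a `G ∈ Λ` that is a unit in `Λ ⧸ I` is a unit;
* the candidate `TwistedUnitAt W p j` («the quotient `G` with `ϖ·L_p = ι(c·G)`, `char X = (c)`, is a
  unit MODULO `(t_j)`», i.e. Mazur's main conjecture READ AT THE TWIST POINT `t_j`) and the door
  `mazurMainConjecture_of_twistedUnitAt : hW16 → … → TwistedUnitAt W p j → MazurMainConjecture W p`.

Why the lens is retired rather than carded (memo §2–§3, desk census `fals/twist_prediction.tsv`):
twisting by `κ^j` is an autoequivalence of `Λ`-modules; for `j ∈ (p−1)ℤ` the lattices `T_pE(j)` and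
`T_pE` agree modulo `p^{1+v_p(j/(p−1))}`, so every residual object (Kolyvagin system, cup products,
GV comparison, generator counts) is identical; and at every point of valuation `≥ 1` the twisted
Euler-characteristic identity is term-by-term `BSD_p(E_•)` on all 7 open cells of the window census
(root valuations `≤ 1`, `v_p(c_ℓ) ≤ 1`, `a = 1`), while points of valuation `< 1` are the lane's
`λ`-inequality at a finite layer.  So `TwistedUnitAt` is recorded as a typed NEGATIVE: a reformulation
with no leverage, kept so that no later seat re-derives it.
-/

set_option autoImplicit false

noncomputable section

open scoped Classical MatrixGroups ModularForm

open CongruenceSubgroup WeierstrassCurve Literature.NumberTheory.EllipticCurves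
  Literature.NumberTheory.EllipticCurves.ModularForms

set_option linter.dupNamespace false

namespace Summit.BirchSwinnertonDyer.BirchSwinnertonDyer.Cruxes.MazurMCOnX1RankZero.TwistRelocation

open Summit.BirchSwinnertonDyer.BirchSwinnertonDyer.Theorems.Rank1ResidualX1Defs (MazurMainConjecture)

section Algebra

variable (p : ℕ) [Fact p.Prime]

/-- **Unit lifting through a quotient of the local ring `Λ`.** If `I ⊆ 𝔪_Λ` and the image of `G` in
`Λ ⧸ I` is a unit, then `G ∈ Λˣ` (`Λ` local: a non-unit `G` lies in `𝔪_Λ`, and `G·H − 1 ∈ I ⊆ 𝔪_Λ`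
would put `1` in `𝔪_Λ`). [folklore] -/
theorem isUnit_of_isUnit_mk {I : Ideal (IwasawaAlgebra p)}
    (hI : I ≤ IsLocalRing.maximalIdeal (IwasawaAlgebra p)) {G : IwasawaAlgebra p}
    (h : IsUnit (Ideal.Quotient.mk I G)) : IsUnit G := by
  by_contra hG
  have hGm : G ∈ IsLocalRing.maximalIdeal (IwasawaAlgebra p) :=
    (IsLocalRing.mem_maximalIdeal _).mpr hG
  obtain ⟨u, hu⟩ := h
  obtain ⟨H, hH⟩ := Ideal.Quotient.mk_surjective (↑u⁻¹ : IwasawaAlgebra p ⧸ I)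
  have h1 : Ideal.Quotient.mk I (G * H) = Ideal.Quotient.mk I 1 := by
    rw [map_mul, map_one, hH, ← hu, Units.mul_inv]
  have h2 : G * H - 1 ∈ I := (Ideal.Quotient.eq).mp h1
  have h3 : (1 : IwasawaAlgebra p) ∈ IsLocalRing.maximalIdeal (IwasawaAlgebra p) := by
    have e : G * H - (G * H - 1) = 1 := by ring
    rw [← e]
    exact Ideal.sub_mem _ (Ideal.mul_mem_right _ _ hGm) (hI h2)
  exact (mem_nonunits_iff.mp ((IsLocalRing.mem_maximalIdeal _).mp h3)) isUnit_one

/-- The twist constant `u^j − 1 ∈ ℤ_p`, `u = cyclotomicGenerator p = 1 + p^{e₀}`: the point of the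
open unit disc at which `T = γ − 1` is evaluated when the cyclotomic variable is twisted by `κ^j`
(`γ ↦ κ(γ)^j γ`, so `T ↦ u^j (1+T) − 1`, and `T = 0 ↦ u^j − 1`). [folklore] -/
def twistConst (j : ℕ) : ℤ_[p] := ((cyclotomicGenerator p ^ j : ℕ) : ℤ_[p]) - 1

/-- The twist element `t_j = T − (u^j − 1) ∈ Λ`, generator of the kernel of the specialisation
`Λ → ℤ_p`, `T ↦ u^j − 1` (Greenberg's `σ_s`, `ker σ_s = (θ_s)`). [folklore] -/
def twistElt (j : ℕ) : IwasawaAlgebra p := PowerSeries.X - PowerSeries.C (twistConst p j)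

/-- `u^j − 1 ∈ 𝔪_{ℤ_p} = (p)`: `u − 1 = p^{e₀}` divides `u^j − 1`, and `e₀ ≥ 1`. [folklore] -/
theorem twistConst_mem_maximalIdeal (j : ℕ) :
    twistConst p j ∈ IsLocalRing.maximalIdeal ℤ_[p] := by
  rw [PadicInt.maximalIdeal_eq_span_p, Ideal.mem_span_singleton]
  have hdvd : (p ^ cyclotomicExponent p : ℕ) ∣ cyclotomicGenerator p ^ j - 1 := by
    have h := Nat.sub_dvd_pow_sub_pow (cyclotomicGenerator p) 1 j
    simpa [cyclotomicGenerator, one_pow] using h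
  obtain ⟨m, hm⟩ := hdvd
  have h1 : 1 ≤ cyclotomicGenerator p ^ j :=
    Nat.one_le_pow _ _ (by unfold cyclotomicGenerator; omega)
  have hcast : twistConst p j = ((cyclotomicGenerator p ^ j - 1 : ℕ) : ℤ_[p]) := by
    unfold twistConst
    rw [Nat.cast_sub h1, Nat.cast_one]
  have he : 1 ≤ cyclotomicExponent p := by
    unfold cyclotomicExponent; split <;> omega
  refine ⟨(p : ℤ_[p]) ^ (cyclotomicExponent p - 1) * m, ?_⟩
  rw [hcast, hm, Nat.cast_mul, Nat.cast_pow, ← mul_assoc, ← pow_succ', Nat.sub_add_cancel he]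

/-- `t_j ∈ 𝔪_Λ` (the tree's `X_sub_C_mem_maximalIdeal`). [folklore] -/
theorem twistElt_mem_maximalIdeal (j : ℕ) :
    twistElt p j ∈ IsLocalRing.maximalIdeal (IwasawaAlgebra p) :=
  IwasawaAlgebra.X_sub_C_mem_maximalIdeal p (twistConst_mem_maximalIdeal p j)

/-- `(t_j) ⊆ 𝔪_Λ`. [folklore] -/
theorem span_twistElt_le_maximalIdeal (j : ℕ) :
    Ideal.span {twistElt p j} ≤ IsLocalRing.maximalIdeal (IwasawaAlgebra p) :=
  (Ideal.span_singleton_le_iff_mem _).mpr (twistElt_mem_maximalIdeal p j)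

end Algebra

section Door

variable (W : WeierstrassCurve ℚ) [W.IsElliptic] [W.IsGloballyMinimal] (p : ℕ) [Fact p.Prime]

/-- **Typed candidate `C⁺(j)` of the lens — «Mazur's main conjecture read at the twist point
`t_j = T − (u^j − 1)`».** In the binders of `MazurMainConjecture`: a generator `c` of `char_Λ X`
and a quotient `G` with `ι(c·G) = ϖ·L_p(f, α)` (this much is Kato–Wuthrich, `hW16`, plus
principality of `char_Λ X`) such that `G` is a unit MODULO `(t_j)`, i.e. the `p`-adic number
`G(u^j − 1)` is a unit — the Euler-characteristic / `p`-part-of-TNC identity for `T_pE ⊗ κ^j` at ONE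
non-critical twist.  Equivalent to `MazurMainConjecture W p` given `hW16` (door below; converse:
take `G = 1`).  Verdict (lens memo): a COSTUME of `BSD_p` at `T = 0` on every open cell. [folklore] -/
def TwistedUnitAt (j : ℕ) : Prop :=
  ∀ (κ : ZpExtension ℚ p) (γ : Field.absoluteGaloisGroup ℚ),
      κ.IsCyclotomic → κ.IsTopGenerator γ → IsCyclotomicVariable p γ →
    ∀ [NeZero (W.conductorNorm ℤ)] (f : CuspForm (Gamma0 (W.conductorNorm ℤ)) 2),
      IsNewformOf W f → ∀ (ϖ : ℚ), (ϖ : ℝ) * W.realPeriodRat = plusPeriod f →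
    ∀ (D : W.SelmerDualData κ γ), ∃ c G : IwasawaAlgebra p, D.charIdeal = Ideal.span {c} ∧
        iwasawaToPowerSeries p (c * G) =
          PowerSeries.C (ϖ : ℚ_[p]) * padicLFunction f (unitRoot W p : ℚ_[p]) ∧
        IsUnit (Ideal.Quotient.mk (Ideal.span {twistElt p j}) G)

/-- **DOOR.** `TwistedUnitAt W p j` for ONE `j` gives Mazur's main conjecture at the pair; the
`Λ`-torsion clause is Kato–Wuthrich (Thm. 16: `p ≠ 2`, ordinary, `E[p]` reducible — all true on X1).
Proof: `(t_j) ⊆ 𝔪_Λ`, so a unit modulo `(t_j)` is a unit (`isUnit_of_isUnit_mk`), and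
`(c·G) = (c)`. [cite: Wuthrich2014, Thm. 16 (p. 397)] -/
theorem mazurMainConjecture_of_twistedUnitAt
    (hW16 : Wuthrich2014.charIdeal_dvd_padicLFunction) (hp : p ≠ 2) (hord : IsOrdinaryAt W p)
    (hred : ¬ W.HasIrreducibleModPGaloisRep p) (j : ℕ) (h : TwistedUnitAt W p j) :
    MazurMainConjecture W p := by
  intro κ γ hκ hγ hγ' _ f hf ϖ hϖ D
  obtain ⟨htors, -⟩ := hW16 W p hp hord hred hκ hγ hγ' hf D ϖ hϖ
  obtain ⟨c, G, hc, hι, hu⟩ := h κ γ hκ hγ hγ' f hf ϖ hϖ D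
  have hG : IsUnit G := isUnit_of_isUnit_mk p (span_twistElt_le_maximalIdeal p j) hu
  have hspan : Ideal.span {c * G} = Ideal.span ({c} : Set (IwasawaAlgebra p)) :=
    Ideal.span_singleton_mul_right_unit hG c
  exact ⟨htors, c * G, hc.trans hspan.symm, hι⟩

/-- **Converse (so `C⁺(j)` is a REFORMULATION, not a weakening): the main conjecture gives
`TwistedUnitAt W p j` for every `j`** (take `c = g`, `G = 1`). [folklore] -/
theorem twistedUnitAt_of_mazurMainConjecture (j : ℕ) (h : MazurMainConjecture W p) :
    TwistedUnitAt W p j := by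
  intro κ γ hκ hγ hγ' _ f hf ϖ hϖ D
  obtain ⟨-, g, hg, hι⟩ := h κ γ hκ hγ hγ' f hf ϖ hϖ D
  exact ⟨g, 1, hg, by simpa using hι, by simp⟩

end Door

end Summit.BirchSwinnertonDyer.BirchSwinnertonDyer.Cruxes.MazurMCOnX1RankZero.TwistRelocation

end
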